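import Summits.KontsevichZagierPeriods.KontsevichZagierPeriods.Theorems.FiveTermTransfer.Negative.Algebraicity

/-!
# `ZagierDilogarithmConjecture` (stmt-KontsevichZagierPeriods-10550) — negative knowledge II: a Dehn-type invariant killing every dilogarithm relator

For additive characters `u, v : ℂˣ → ℚ` (extended by `0 ↦ 0` to `ℂ`, `ext`) the symbol
`φ(z) = u(z)·v(1 − z) − v(z)·u(1 − z)` (an alternating pairing evaluated on the Bloch symbol
`z ∧ (1 − z)`, Dupont–Sah 1982 §4) satisfies the five-term identity EXACTLY for all
`x ≠ y ∈ ℂ ∖ {0,1}` (`sym_fiveTerm`; torsion is invisible to `ℚ`); its anti-symmetrisation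
`ψ(z) = φ(z) − φ(z̄)` also kills `[w] + [w̄]` and `[w]` (`w` real), so the additive map
`dehn u v : FreeAbelianGroup ℂ →+ ℚ`, `[z] ↦ ψ(z)`, vanishes on `AddSubgroup.closure dilogRelators`
(`dehn_eq_zero_of_mem_closure`). `exists_addMonoidHom_eq_one_eq_zero`: characters with prescribed
values exist (injectivity of the divisible group `ℚ`, `Module.Baer.of_divisible`);
`zpow_mul_zpow_eq_one_of_smul` reads additive relations in `Additive ℂˣ` multiplicatively.
Part III (`DehnWitness`) evaluates the invariant at `(2 ∓ 4i)/5`.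
Sorry-free, axioms ⊆ {propext, Classical.choice, Quot.sound}.
-/

noncomputable section

open Complex MeasureTheory Set
open scoped ComplexConjugate

namespace Summit.KontsevichZagierPeriods.HyperbolicBloch.ZagierDilogarithmConjectureNegative

open Literature.NumberTheory.Transcendental
open Summit.KontsevichZagierPeriods.KontsevichZagierPeriods.Theses.HyperbolicBloch
  (ZagierDilogarithmConjecture)
open Summit.KontsevichZagierPeriods.HyperbolicBloch.FiveTermTransferNegative
  (L not_isAlgebraic_L xL xL_re xL_im not_isAlgebraic_xL isAlgebraic_of_eq_rat)

/-! ## §5 A Dehn-type invariant `ℤ[ℂ] → ℚ` vanishing on every dilogarithm relator -/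

section ext
variable (u : Additive ℂˣ →+ ℚ)

/-- Extension by `0 ↦ 0` of a homomorphism `ℂˣ → ℚ` to a function on `ℂ`. -/
def ext (z : ℂ) : ℚ :=
  if h : z = 0 then 0 else u (Additive.ofMul (Units.mk0 z h))

/-- Auxiliary: `ext_of_ne`. [folklore] -/
theorem ext_of_ne {z : ℂ} (h : z ≠ 0) : ext u z = u (Additive.ofMul (Units.mk0 z h)) := by
  simp [ext, h]

/-- Auxiliary: `ext_mul`. [folklore] -/
theorem ext_mul {p q : ℂ} (hp : p ≠ 0) (hq : q ≠ 0) : ext u (p * q) = ext u p + ext u q := by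
  rw [ext_of_ne u hp, ext_of_ne u hq, ext_of_ne u (mul_ne_zero hp hq), ← map_add, ← ofMul_mul]
  congr 2
  ext
  simp

/-- Auxiliary: `ext_one`. [folklore] -/
theorem ext_one : ext u 1 = 0 := by
  have h := ext_mul u one_ne_zero one_ne_zero
  rw [one_mul] at h
  linarith

/-- Auxiliary: `ext_inv`. [folklore] -/
theorem ext_inv {p : ℂ} (hp : p ≠ 0) : ext u p⁻¹ = -ext u p := by
  have h := ext_mul u hp (inv_ne_zero hp)
  rw [mul_inv_cancel₀ hp, ext_one] at h
  linarith

/-- Auxiliary: `ext_div`. [folklore] -/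
theorem ext_div {p q : ℂ} (hp : p ≠ 0) (hq : q ≠ 0) : ext u (p / q) = ext u p - ext u q := by
  rw [div_eq_mul_inv, ext_mul u hp (inv_ne_zero hq), ext_inv u hq, sub_eq_add_neg]

/-- Auxiliary: `ext_neg_one`. [folklore] -/
theorem ext_neg_one : ext u (-1) = 0 := by
  have h := ext_mul u (p := -1) (q := -1) (by norm_num) (by norm_num)
  rw [neg_one_mul, neg_neg, ext_one] at h
  linarith

/-- Auxiliary: `ext_neg`. [folklore] -/
theorem ext_neg {p : ℂ} (hp : p ≠ 0) : ext u (-p) = ext u p := by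
  rw [← neg_one_mul, ext_mul u (by norm_num) hp, ext_neg_one, zero_add]

/-- `ext u` kills roots of unity: if `p ^ n = 1` (`n ≥ 1`) then `ext u p = 0`. -/
theorem ext_eq_zero_of_pow_eq_one {p : ℂ} {n : ℕ} (hn : n ≠ 0) (h : p ^ n = 1) : ext u p = 0 := by
  have hp : p ≠ 0 := by
    rintro rfl
    rw [zero_pow hn] at h
    exact zero_ne_one h
  have key : ∀ m : ℕ, ext u (p ^ m) = m * ext u p := by
    intro m
    induction m with
    | zero => simp [ext_one]
    | succ m ih => rw [pow_succ, ext_mul u (pow_ne_zero m hp) hp, ih]; push_cast; ring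
  have := key n
  rw [h, ext_one] at this
  have hn' : (n : ℚ) ≠ 0 := Nat.cast_ne_zero.mpr hn
  have : (n : ℚ) * ext u p = 0 := this.symm
  simpa [hn'] using this

/-- The four field identities behind the five-term relation. -/
theorem fiveTerm_args {x y : ℂ} (hx0 : x ≠ 0) (hy0 : y ≠ 0) (hy1 : y ≠ 1) :
    1 - y / x = (x - y) / x ∧
    (1 - x⁻¹) / (1 - y⁻¹) = ((1 - x) * y) / (x * (1 - y)) ∧
    1 - (1 - x⁻¹) / (1 - y⁻¹) = (x - y) / (x * (1 - y)) ∧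
    1 - (1 - x) / (1 - y) = (x - y) / (1 - y) := by
  have hy1' : (1 - y) ≠ 0 := sub_ne_zero.mpr (Ne.symm hy1)
  refine ⟨?_, ?_, ?_, ?_⟩
  · field_simp
  · field_simp
    ring
  · field_simp
    ring
  · field_simp
    ring

/-- Values of `ext u` at the five-term arguments. -/
theorem ext_fiveTerm_args {x y : ℂ} (hx0 : x ≠ 0) (hx1 : x ≠ 1) (hy0 : y ≠ 0) (hy1 : y ≠ 1)
    (hxy : x ≠ y) :
    ext u (y / x) = ext u y - ext u x ∧
    ext u (1 - y / x) = ext u (x - y) - ext u x ∧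
    ext u ((1 - x⁻¹) / (1 - y⁻¹)) = ext u (1 - x) + ext u y - ext u x - ext u (1 - y) ∧
    ext u (1 - (1 - x⁻¹) / (1 - y⁻¹)) = ext u (x - y) - ext u x - ext u (1 - y) ∧
    ext u ((1 - x) / (1 - y)) = ext u (1 - x) - ext u (1 - y) ∧
    ext u (1 - (1 - x) / (1 - y)) = ext u (x - y) - ext u (1 - y) := by
  have hx1' : (1 - x) ≠ 0 := sub_ne_zero.mpr (Ne.symm hx1)
  have hy1' : (1 - y) ≠ 0 := sub_ne_zero.mpr (Ne.symm hy1)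
  have hxy' : x - y ≠ 0 := sub_ne_zero.mpr hxy
  obtain ⟨e1, e2, e3, e4⟩ := fiveTerm_args hx0 hy0 hy1
  refine ⟨ext_div u hy0 hx0, ?_, ?_, ?_, ext_div u hx1' hy1', ?_⟩
  · rw [e1, ext_div u hxy' hx0]
  · rw [e2, ext_div u (mul_ne_zero hx1' hy0) (mul_ne_zero hx0 hy1'), ext_mul u hx1' hy0,
      ext_mul u hx0 hy1']
    ring
  · rw [e3, ext_div u hxy' (mul_ne_zero hx0 hy1'), ext_mul u hx0 hy1']
    ring
  · rw [e4, ext_div u hxy' hy1']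

end ext

section sym
variable (u v : Additive ℂˣ →+ ℚ)

/-- The symbol `φ(z) = u(z)·v(1 − z) − v(z)·u(1 − z)`: an alternating pairing of two additive
characters of `ℂˣ` evaluated on `z ∧ (1 − z)`. -/
def sym (z : ℂ) : ℚ := ext u z * ext v (1 - z) - ext v z * ext u (1 - z)

/-- **The five-term identity for the symbol**, exact for ALL `x ≠ y` in `ℂ ∖ {0, 1}`. -/
theorem sym_fiveTerm {x y : ℂ} (hx0 : x ≠ 0) (hx1 : x ≠ 1) (hy0 : y ≠ 0) (hy1 : y ≠ 1)
    (hxy : x ≠ y) :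
    sym u v x - sym u v y + sym u v (y / x) - sym u v ((1 - x⁻¹) / (1 - y⁻¹)) +
      sym u v ((1 - x) / (1 - y)) = 0 := by
  obtain ⟨a1, a2, a3, a4, a5, a6⟩ := ext_fiveTerm_args u hx0 hx1 hy0 hy1 hxy
  obtain ⟨b1, b2, b3, b4, b5, b6⟩ := ext_fiveTerm_args v hx0 hx1 hy0 hy1 hxy
  simp only [sym]
  rw [a1, a2, a3, a4, a5, a6, b1, b2, b3, b4, b5, b6]
  ring

/-- The anti-symmetrised symbol `ψ(z) = φ(z) − φ(z̄)`. -/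
def asym (z : ℂ) : ℚ := sym u v z - sym u v (conj z)

/-- **The Dehn-type invariant** `δ : ℤ[ℂ] → ℚ`, `[z] ↦ ψ(z)`. -/
def dehn : FreeAbelianGroup ℂ →+ ℚ := FreeAbelianGroup.lift (asym u v)

/-- Auxiliary: `dehn_of`. [folklore] -/
@[simp] theorem dehn_of (z : ℂ) : dehn u v (FreeAbelianGroup.of z) = asym u v z := by
  simp [dehn]

/-- `δ` kills every dilogarithm relator (five-term for all `x ≠ y ∉ {0,1}`, no algebraicity used;
`[w] + [w̄]`; `[w]` real). -/
theorem dehn_eq_zero_of_mem_dilogRelators {c : FreeAbelianGroup ℂ} (hc : c ∈ dilogRelators) :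
    dehn u v c = 0 := by
  rcases hc with (⟨x, y, -, -, hx0, hx1, hy0, hy1, hxy, rfl⟩ | ⟨w, -, rfl⟩) | ⟨w, hw, rfl⟩
  · have hx0' : conj x ≠ 0 := (map_ne_zero _).mpr hx0
    have hy0' : conj y ≠ 0 := (map_ne_zero _).mpr hy0
    have hx1' : conj x ≠ 1 := fun e => hx1 (by rw [← conj_conj x, e, map_one])
    have hy1' : conj y ≠ 1 := fun e => hy1 (by rw [← conj_conj y, e, map_one])
    have hxy' : conj x ≠ conj y := fun e => hxy (by rw [← conj_conj x, e, conj_conj])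
    have h1 := sym_fiveTerm u v hx0 hx1 hy0 hy1 hxy
    have h2 := sym_fiveTerm u v hx0' hx1' hy0' hy1' hxy'
    simp only [map_add, map_sub, dehn_of, asym, map_div₀, map_one, map_inv₀]
    linarith
  · simp [asym]
  · have e : conj w = w := Complex.conj_eq_iff_im.mpr hw
    simp [asym, e]

/-- Auxiliary: `dehn_eq_zero_of_mem_closure`. [folklore] -/
theorem dehn_eq_zero_of_mem_closure {c : FreeAbelianGroup ℂ}
    (hc : c ∈ AddSubgroup.closure dilogRelators) : dehn u v c = 0 := by
  have hle : AddSubgroup.closure dilogRelators ≤ (dehn u v).ker :=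
    (AddSubgroup.closure_le _).mpr fun c hc => dehn_eq_zero_of_mem_dilogRelators u v hc
  exact hle hc

end sym

/-! ### Additive characters of `ℂˣ` with prescribed values (injectivity of `ℚ`) -/

/-- **Extension lemma.** If no relation `a • x₀ + b • x₁ = 0` has `a ≠ 0`, there is an additive
map `φ : X → ℚ` with `φ x₀ = 1`, `φ x₁ = 0` (define it on the line through the image of `x₀` in
`X ⧸ ℤx₁` and extend by the injectivity of the divisible group `ℚ`, `Module.Baer.of_divisible`).
[folklore] -/
theorem exists_addMonoidHom_eq_one_eq_zero {X : Type*} [AddCommGroup X] (x₀ x₁ : X)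
    (hx : ∀ a b : ℤ, a • x₀ + b • x₁ = 0 → a = 0) :
    ∃ φ : X →+ ℚ, φ x₀ = 1 ∧ φ x₁ = 0 := by
  let N : Submodule ℤ X := Submodule.span ℤ {x₁}
  have hx' : ∀ M : ℤ, M • x₀ ∈ N → M = 0 := by
    intro M hM
    obtain ⟨b, hb⟩ := Submodule.mem_span_singleton.mp hM
    refine hx M (-b) ?_
    rw [neg_smul, ← hb, add_neg_cancel]
  have H : ∀ c : ℤ, c • (N.mkQ x₀) = 0 → (RingHom.id ℤ) c • (1 : ℚ) = 0 := by
    intro c hc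
    have hc' : N.mkQ (c • x₀) = 0 := by rw [map_zsmul]; exact hc
    rw [Submodule.mkQ_apply, Submodule.Quotient.mk_eq_zero] at hc'
    rw [hx' c hc', RingHom.id_apply, zero_smul]
  have hmem : N.mkQ x₀ ∈ (LinearPMap.mkSpanSingleton' (N.mkQ x₀) (1 : ℚ) H).domain :=
    Submodule.mem_span_singleton_self _
  obtain ⟨ψ, hψ⟩ := (Module.Baer.of_divisible ℚ).extension_property _
    (LinearPMap.mkSpanSingleton' (N.mkQ x₀) (1 : ℚ) H).domain.injective_subtype
    (LinearPMap.mkSpanSingleton' (N.mkQ x₀) (1 : ℚ) H).toFun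
  refine ⟨(ψ ∘ₗ N.mkQ).toAddMonoidHom, ?_, ?_⟩
  · change ψ (N.mkQ x₀) = 1
    have e := DFunLike.congr_fun hψ ⟨N.mkQ x₀, hmem⟩
    rw [LinearMap.comp_apply, Submodule.subtype_apply] at e
    rw [e]
    exact LinearPMap.mkSpanSingleton'_apply_self _ (1 : ℚ) H hmem
  · change ψ (N.mkQ x₁) = 0
    rw [Submodule.mkQ_apply, (Submodule.Quotient.mk_eq_zero N).2 (Submodule.subset_span rfl),
      map_zero]

/-- Reading an additive relation in `Additive ℂˣ` as a multiplicative one in `ℂ`. [folklore] -/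
theorem zpow_mul_zpow_eq_one_of_smul {w q : ℂ} (hw : w ≠ 0) (hq : q ≠ 0) {a b : ℤ}
    (H : a • Additive.ofMul (Units.mk0 w hw) + b • Additive.ofMul (Units.mk0 q hq) = 0) :
    w ^ a * q ^ b = 1 := by
  have e := congrArg (fun t : Additive ℂˣ => ((Additive.toMul t : ℂˣ) : ℂ)) H
  simpa [toMul_add, toMul_zsmul, Units.val_zpow_eq_zpow_val] using e

end Summit.KontsevichZagierPeriods.HyperbolicBloch.ZagierDilogarithmConjectureNegative

end
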